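import Mathlib.Analysis.CStarAlgebra.Basic
import HarnessLib

/-!
# Prop 7, route-R E′, (E1-c) brick F4d(i) — THE CONJUGATION COEFFICIENT `ĉ₁(a)Z := aZa* − Z` (the `P₁ = Ad(u)(log E) − log E` piece): F1's HYPOTHESES ON THE UNIT BALL, `κ = 2`, `θ = 4`

Route `UnitScaleTilt`, crux K1 child «MinimiserStabilityRegPr» (`stmt-QuantumFields-19200`), cell ym3-torus, width seat px15 (gen 2); pen «px15 g2: (E1-c) GO-LOCATE» (★p1 g15,
2026-08-28T20:45:05Z), LOCATE `LOCATE-E1C-DIVLIPSCHITZ-px15g2.md` §6 (F4: `P₁` via F1's equivariant product rule).  THEOREMS ONLY (0 `def`, 0 `sorry`); `--supports stmt-QuantumFields-19200`,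
count-neutral.  YM₃ on T³ is a ladder rung (R3), not the Clay problem; nothing here claims the stub, the crux, d = 4 or the mass gap.

WHAT.  The first piece of F2 ✓p668882's trisection is `P₁ = u·log E·u* − log E = ĉ₁(u)(log E)`, `ĉ₁(a)Z := aZa* − Z`, with `u = e^{c•ψ}` unitary and `log E` the DATA chart (no `ψ`).
For F4c(ii) ✓p672165 `norm_divB_coeffDiff_le` (generic coefficient, LOCAL rows on a ball) one needs, on the unit ball `‖a‖ ≤ 1` of any normed *-ring with `‖a*‖ = ‖a‖`:
`conjCoeff_map_sub`, `conjCoeff_map_sum` (additivity), ★ `conjCoeff_equivariant` (for a *-preserving conjugation `Φ(M) = vMv⁻¹`, `Φ(M*) = Φ(M)*`: `Φ(ĉ₁(a)Z) = ĉ₁(Φa)(ΦZ)`),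
`norm_conjCoeff_le` (cone: `‖ĉ₁(a)Z‖ ≤ (2 + ‖a − 1‖)‖a − 1‖‖Z‖`, and `≤ 3‖a−1‖‖Z‖` when `‖a−1‖ ≤ 1`), ★ `norm_conjCoeff_sub_le` (`κ = 2`: `‖ĉ₁(a)Z − ĉ₁(b)Z‖ ≤ 2‖a − b‖‖Z‖`),
★★ `norm_conjCoeff_secondDiff_le` (`θ = 4`: `‖[(ĉ₁a − ĉ₁b) − (ĉ₁a′ − ĉ₁b′)]Z‖ ≤ 4(‖(a−b)−(a′−b′)‖ + 2‖a′−b′‖(‖a−a′‖ + ‖b−b′‖))‖Z‖`, the shape of F4c(ii)'s `hθ`; cf. F2's SU version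
`norm_conj_secondDiff_le`).  HONEST SCOPE.  Elementary ([folklore]).

References: T. Bałaban, CMP 98 (1985) 17–51 [Balaban1985Averaging] ((19)–(21) p.21); [folklore].
-/

set_option autoImplicit false

namespace Summit.QuantumFields.YangMills.Theorems.Prop7ConjCoeffRows

variable {E : Type*} [NormedRing E] [StarRing E] [NormedStarGroup E]

omit [NormedStarGroup E] in
/-- Additivity in `Z`. [folklore] -/
theorem conjCoeff_map_sub (a Z Z' : E) : (a * (Z - Z') * star a - (Z - Z')) = (a * Z * star a - Z) - (a * Z' * star a - Z') := by
  noncomm_ring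

omit [NormedStarGroup E] in
/-- Finite sums in `Z`. [folklore] -/
theorem conjCoeff_map_sum {ι : Type*} (s : Finset ι) (a : E) (f : ι → E) :
    (a * (∑ μ ∈ s, f μ) * star a - ∑ μ ∈ s, f μ) = ∑ μ ∈ s, (a * f μ * star a - f μ) := by
  rw [Finset.mul_sum, Finset.sum_mul, ← Finset.sum_sub_distrib]

omit [NormedStarGroup E] in
/-- ★ EQUIVARIANCE under a multiplicative, additive, *-preserving map `Φ` (a unitary conjugation): `Φ(aZa* − Z) = Φ(a)Φ(Z)Φ(a)* − Φ(Z)`. [folklore] -/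
theorem conjCoeff_equivariant (Φ : E → E) (hmul : ∀ x y, Φ (x * y) = Φ x * Φ y) (hsub : ∀ x y, Φ (x - y) = Φ x - Φ y)
    (hstar : ∀ x, Φ (star x) = star (Φ x)) (a Z : E) :
    Φ (a * Z * star a - Z) = Φ a * Φ Z * star (Φ a) - Φ Z := by
  rw [hsub, hmul, hmul, hstar]

omit [NormedStarGroup E] in
/-- `aZa* − bZb* = (a−b)Za* + bZ(a−b)*`. [folklore] -/
theorem conj_sub_conj_eq' (a b Z : E) : a * Z * star a - b * Z * star b = (a - b) * Z * star a + b * Z * star (a - b) := by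
  rw [star_sub]; noncomm_ring

/-- CONE SIZE: `‖aZa* − Z‖ ≤ (2 + ‖a − 1‖)·‖a − 1‖·‖Z‖`. [cite: Balaban1985Averaging, (19)-(21) p.21] -/
theorem norm_conjCoeff_le [NormOneClass E] (a Z : E) : ‖a * Z * star a - Z‖ ≤ (2 + ‖a - 1‖) * ‖a - 1‖ * ‖Z‖ := by
  have e : a * Z * star a - Z = (a - 1) * Z * star a + Z * star (a - 1) := by
    rw [star_sub, star_one]; noncomm_ring
  rw [e]
  have hsa : ‖star a‖ ≤ ‖a - 1‖ + 1 := by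
    rw [norm_star]
    calc ‖a‖ = ‖(a - 1) + 1‖ := by rw [sub_add_cancel]
      _ ≤ ‖a - 1‖ + ‖(1 : E)‖ := norm_add_le _ _
      _ = ‖a - 1‖ + 1 := by rw [norm_one]
  have h0 : 0 ≤ ‖a - 1‖ := norm_nonneg _
  have hZ : 0 ≤ ‖Z‖ := norm_nonneg _
  calc ‖(a - 1) * Z * star a + Z * star (a - 1)‖ ≤ ‖a - 1‖ * ‖Z‖ * ‖star a‖ + ‖Z‖ * ‖star (a - 1)‖ := by
        refine (norm_add_le _ _).trans (add_le_add ?_ (norm_mul_le _ _))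
        exact (norm_mul_le _ _).trans (mul_le_mul_of_nonneg_right (norm_mul_le _ _) (norm_nonneg _))
    _ ≤ ‖a - 1‖ * ‖Z‖ * (‖a - 1‖ + 1) + ‖Z‖ * ‖a - 1‖ := by
        rw [norm_star (a - 1)]
        exact add_le_add (mul_le_mul_of_nonneg_left hsa (mul_nonneg h0 hZ)) le_rfl
    _ = (2 + ‖a - 1‖) * ‖a - 1‖ * ‖Z‖ := by ring

/-- Cone size in the small regime: `‖a − 1‖ ≤ 1` ⇒ `‖aZa* − Z‖ ≤ 3‖a − 1‖‖Z‖`. [cite: Balaban1985Averaging, (19)-(21) p.21] -/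
theorem norm_conjCoeff_le_three_mul [NormOneClass E] {a : E} (ha : ‖a - 1‖ ≤ 1) (Z : E) : ‖a * Z * star a - Z‖ ≤ 3 * ‖a - 1‖ * ‖Z‖ := by
  refine (norm_conjCoeff_le a Z).trans ?_
  have h0 : 0 ≤ ‖a - 1‖ := norm_nonneg _
  have hZ : 0 ≤ ‖Z‖ := norm_nonneg _
  have h := mul_nonneg (mul_nonneg (sub_nonneg.2 ha) h0) hZ
  nlinarith [h]

/-- ★ LIPSCHITZ `κ = 2` on the unit ball: `‖a‖,‖b‖ ≤ 1` ⇒ `‖(aZa* − Z) − (bZb* − Z)‖ ≤ 2‖a − b‖‖Z‖`. [cite: Balaban1985Averaging, (19)-(21) p.21] -/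
theorem norm_conjCoeff_sub_le {a b : E} (ha : ‖a‖ ≤ 1) (hb : ‖b‖ ≤ 1) (Z : E) :
    ‖(a * Z * star a - Z) - (b * Z * star b - Z)‖ ≤ 2 * ‖a - b‖ * ‖Z‖ := by
  rw [sub_sub_sub_cancel_right, conj_sub_conj_eq']
  have hZ : 0 ≤ ‖Z‖ := norm_nonneg _
  have h0 : 0 ≤ ‖a - b‖ := norm_nonneg _
  calc ‖(a - b) * Z * star a + b * Z * star (a - b)‖ ≤ ‖a - b‖ * ‖Z‖ * ‖star a‖ + ‖b‖ * ‖Z‖ * ‖star (a - b)‖ := by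
        refine (norm_add_le _ _).trans (add_le_add ?_ ?_)
        · exact (norm_mul_le _ _).trans (mul_le_mul_of_nonneg_right (norm_mul_le _ _) (norm_nonneg _))
        · exact (norm_mul_le _ _).trans (mul_le_mul_of_nonneg_right (norm_mul_le _ _) (norm_nonneg _))
    _ ≤ ‖a - b‖ * ‖Z‖ * 1 + 1 * ‖Z‖ * ‖a - b‖ := by
        rw [norm_star, norm_star]
        exact add_le_add (mul_le_mul_of_nonneg_left ha (mul_nonneg h0 hZ)) (mul_le_mul_of_nonneg_right (mul_le_mul_of_nonneg_right hb hZ) h0)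
    _ = 2 * ‖a - b‖ * ‖Z‖ := by ring

/-- ★★ FOUR-POINT ROW `θ = 4` on the unit ball (`‖a′‖` is not needed):
`‖[(ĉ₁a − ĉ₁b) − (ĉ₁a′ − ĉ₁b′)]Z‖ ≤ 4·(‖(a−b)−(a′−b′)‖ + 2‖a′−b′‖(‖a−a′‖ + ‖b−b′‖))·‖Z‖`. [cite: Balaban1985Averaging, (19)-(21) p.21] -/
theorem norm_conjCoeff_secondDiff_le {a b a' b' : E} (ha : ‖a‖ ≤ 1) (hb : ‖b‖ ≤ 1) (hb' : ‖b'‖ ≤ 1) (Z : E) :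
    ‖((a * Z * star a - Z) - (b * Z * star b - Z)) - ((a' * Z * star a' - Z) - (b' * Z * star b' - Z))‖
      ≤ 4 * (‖(a - b) - (a' - b')‖ + 2 * ‖a' - b'‖ * (‖a - a'‖ + ‖b - b'‖)) * ‖Z‖ := by
  have e : ((a * Z * star a - Z) - (b * Z * star b - Z)) - ((a' * Z * star a' - Z) - (b' * Z * star b' - Z))
      = ((a - b) - (a' - b')) * Z * star a + (a' - b') * Z * star (a - a') + (b - b') * Z * star (a - b) + b' * Z * star ((a - b) - (a' - b')) := by
    simp only [star_sub]; noncomm_ring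
  rw [e]
  set Ed := ‖(a - b) - (a' - b')‖ with hEd
  set D := ‖a' - b'‖ with hD
  have hZ : 0 ≤ ‖Z‖ := norm_nonneg _
  have hE0 : 0 ≤ Ed := norm_nonneg _
  have hD0 : 0 ≤ D := norm_nonneg _
  have hab : ‖a - b‖ ≤ D + Ed := by
    calc ‖a - b‖ = ‖(a' - b') + ((a - b) - (a' - b'))‖ := by rw [add_sub_cancel]
      _ ≤ D + Ed := norm_add_le _ _
  have hbb : ‖b - b'‖ ≤ 2 := (norm_sub_le _ _).trans (by linarith)
  have t3 : ∀ (x y w : E), ‖x * Z * star w‖ ≤ ‖x‖ * ‖Z‖ * ‖w‖ := fun x y w => by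
    rw [← norm_star w] ; rw [norm_star]
    calc ‖x * Z * star w‖ ≤ ‖x * Z‖ * ‖star w‖ := norm_mul_le _ _
      _ ≤ ‖x‖ * ‖Z‖ * ‖w‖ := by rw [norm_star]; exact mul_le_mul_of_nonneg_right (norm_mul_le _ _) (norm_nonneg _)
  calc ‖((a - b) - (a' - b')) * Z * star a + (a' - b') * Z * star (a - a') + (b - b') * Z * star (a - b) + b' * Z * star ((a - b) - (a' - b'))‖
      ≤ Ed * ‖Z‖ * ‖a‖ + D * ‖Z‖ * ‖a - a'‖ + ‖b - b'‖ * ‖Z‖ * ‖a - b‖ + ‖b'‖ * ‖Z‖ * Ed := by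
        refine (norm_add_le _ _).trans (add_le_add ((norm_add_le _ _).trans (add_le_add ((norm_add_le _ _).trans (add_le_add ?_ ?_)) ?_)) ?_)
        · exact t3 _ Z a
        · exact t3 _ Z (a - a')
        · exact t3 _ Z (a - b)
        · exact t3 _ Z _
    _ ≤ Ed * ‖Z‖ * 1 + D * ‖Z‖ * ‖a - a'‖ + ‖b - b'‖ * ‖Z‖ * (D + Ed) + 1 * ‖Z‖ * Ed := by
        gcongr
    _ ≤ 4 * (Ed + 2 * D * (‖a - a'‖ + ‖b - b'‖)) * ‖Z‖ := by
        have h1 : ‖b - b'‖ * ‖Z‖ * Ed ≤ 2 * ‖Z‖ * Ed := by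
          have := mul_le_mul_of_nonneg_right (mul_le_mul_of_nonneg_right hbb hZ) hE0; linarith
        have h2 : 0 ≤ D * ‖Z‖ * ‖a - a'‖ := by positivity
        have h3 : 0 ≤ ‖b - b'‖ * ‖Z‖ * D := by positivity
        nlinarith [h1, h2, h3, mul_nonneg hE0 hZ]

end Summit.QuantumFields.YangMills.Theorems.Prop7ConjCoeffRows
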